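import Summits.ABC.StewartYu.ArchG3RecLinesHAtoms
import Summits.ABC.StewartYu.ArchG3RecLinesE
import Summits.ABC.StewartYu.ArchG3RecLinesCK
import HarnessLib

/-!
# The archimedean record `ArchG3Rec` — letter lines in closed form, H family (half step): CORE BOUNDS

Support file (theorems only; no named facts). Cell `abc-stewartyu`, route `YuMatveevShapeRat`, crux r2 `ArchCoreRat` (stmt-ABC-20502),
line `arch-g3-frame`, seam (B) of `stub_recLinesArch`, plan R50 (the half-step family `HalfStepLinesK (2^(n−1)) c lev` is seat p5's).
The currency of the half step at level `lev` is `X·L` (`Z = 8(n+1)·X·L`, threshold copies `2ⁿ·…`); this file bounds every atom of the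
three half-step lines that does NOT involve the start print `cPRK`/the directional factor `DΔC` (those are p1's `…FK`):
* regimes: `T_zero_real` (`T 0 = 8L`), `T_le_four_L` (`T lev ≤ 4L` for `lev ≥ 1`), `gain_zero` (`(8 − 2⁻²⁰)·2ⁿZ ≤` gain at level 0);
* `logWC_half_le` + `rho_bounds` (the three Hasse-weight sizes of the half step, via p1's `logWC_le`/`L₀_mul_le`);
* `nsq_Omega_le` (`n²·Ω, n·ΣA, ΣA, Σ_k Aθ_k, cHR ≤ Z/3072`), `cUR_le'`, `debris_le`;
* `sAbs_sum_le` (`|s|·Σ_j (LνRR/N)·A_j ≤ (2 + 2⁻⁶)·n·X·L`), `exp_consts`, `wl_X_le`.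
(The slab products, `wl·ρ_F`, the `U0`-killed logarithms and the `T′`-costs are in `ArchG3RecLinesHCoreB`.)

## References
* [Nesterenko2003] Yu. V. Nesterenko, LNM 1819 (2003) — §4 (4.3)–(4.5), §4.3 (4.36)–(4.51); shape only.
-/

noncomputable section

open Finset Real
open scoped Nat
open Summit.ABC.StewartYu.ArchSupply (WC)

namespace Summit.ABC.StewartYu

namespace ArchG3Rec

open PadicG3Par (Cb Cb_pos)
open ArchG3Par (G K yloadK G_eq G_pos K_pos yloadK_pos eight_le_G one_le_K)

variable {n : ℕ} (P : ArchG3Rec n)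

/-! ### The two regimes of a half step -/

/-- level `0` is unfloored: `T 0 = 8L` (real form). [cite: Nesterenko2003, (4.3); shape only] -/
theorem T_zero_real : (P.T 0 : ℝ) = 8 * (P.L : ℝ) := by
  have hL := P.L_floors.1
  have h1 : 1 ≤ 8 * P.L := by have : 1 ≤ 2 ^ (n + 25) := Nat.one_le_two_pow; omega
  have h : P.T 0 = 8 * P.L := by
    unfold T
    rw [pow_zero, Nat.div_one, max_eq_right h1]
  exact_mod_cast h

/-- below level `0` the order drop is at most `4L`: `T lev ≤ 4L` for `1 ≤ lev`. [cite: Nesterenko2003, (4.3); shape only] -/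
theorem T_le_four_L {lev : ℕ} (hlev : 1 ≤ lev) : (P.T lev : ℝ) ≤ 4 * P.L := by
  have hL := P.L_floors.1
  have h1 : 1 ≤ 4 * P.L := by have : 1 ≤ 2 ^ (n + 25) := Nat.one_le_two_pow; omega
  have h : P.T lev ≤ 4 * P.L := by
    unfold T
    refine max_le h1 ?_
    have h2 : 2 ≤ 2 ^ lev := by
      calc 2 = 2 ^ 1 := by norm_num
        _ ≤ 2 ^ lev := Nat.pow_le_pow_right (by norm_num) hlev
    calc 8 * P.L / 2 ^ lev ≤ 8 * P.L / 2 := Nat.div_le_div_left h2 (by norm_num)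
      _ = 4 * P.L := by omega
  exact_mod_cast h

/-- **the level-`0` gain**: `(8 − 2⁻²⁰)·2ⁿ·Z ≤ ((2·Nf 0 n + 1)·T 0)·G` (`Xs 0 ≥ X/2·(8L/(8L+1))`, `T 0 = 8L`).
[cite: Nesterenko2003, (4.25); shape only] -/
theorem gain_zero (hn2 : 2 ≤ n) : (8 - 1 / 2 ^ 20) * (2 ^ n * P.Z) ≤ (((2 * P.Nf 0 n + 1) * P.T 0 : ℕ) : ℝ) * G n := by
  have h := P.gain_ge 0 n
  obtain ⟨hNf, -, -, -⟩ := P.nodes_half_le 0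
  rw [pow_zero, one_mul] at hNf
  obtain ⟨-, -, hG, hL0, hX, -, -⟩ := P.letters_real 0
  have hL : (2 : ℝ) ^ 27 ≤ P.L :=
    calc (2 : ℝ) ^ 27 ≤ 2 ^ (n + 25) := pow_le_pow_right₀ (by norm_num) (by omega)
      _ ≤ P.L := P.L_real.2.2.1
  have h2n : (1 : ℝ) ≤ 2 ^ n := one_le_pow₀ (by norm_num)
  have hn0 : (0 : ℝ) ≤ n := Nat.cast_nonneg n
  have hX1 : (1 : ℝ) ≤ P.X := by linarith
  have hZ : P.Z = 8 * ((n : ℝ) + 1) * ((P.X : ℝ) * P.L) := by unfold Z; rw [hG]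
  -- `G·(2Nf+1) ≤ 8(n+1)·2ⁿ·(X+3) ≤ 2ⁿ·Z/2^20`
  have h1 : 2 * (P.Nf 0 n : ℝ) + 1 ≤ 2 ^ n * ((P.X : ℝ) + 3) := by nlinarith
  have h2 : G n * (2 * (P.Nf 0 n : ℝ) + 1) ≤ 8 * ((n : ℝ) + 1) * (2 ^ n * ((P.X : ℝ) + 3)) := by
    rw [hG]; exact mul_le_mul_of_nonneg_left h1 (by positivity)
  have h3 : (P.X : ℝ) + 3 ≤ (P.X : ℝ) * P.L / 2 ^ 20 := by
    rw [le_div_iff₀ (by positivity)]; nlinarith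
  have h4 : 8 * ((n : ℝ) + 1) * (2 ^ n * ((P.X : ℝ) + 3)) ≤ 8 * ((n : ℝ) + 1) * (2 ^ n * ((P.X : ℝ) * P.L / 2 ^ 20)) :=
    mul_le_mul_of_nonneg_left (mul_le_mul_of_nonneg_left h3 (by positivity)) (by positivity)
  rw [hZ]
  have h5 : 8 * ((n : ℝ) + 1) * (2 ^ n * ((P.X : ℝ) * P.L / 2 ^ 20)) = 2 ^ n * (8 * ((n : ℝ) + 1) * ((P.X : ℝ) * P.L)) / 2 ^ 20 := by
    ring
  rw [hZ] at h
  linarith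

/-! ### The Hasse-weight sizes of the half step -/

/-- the three node radii of the half step against p1's `logWC_le` ceiling `2^lev·2^{n+6}·e^G·X`:
`Nh (lev+1)`, `ρ_F = (3e^G+1)(2Nf+1) + Nf` and `Nf = Nf lev n`. [cite: Nesterenko2003, §4.3 (4.44); shape only] -/
theorem rho_bounds (lev : ℕ) :
    (P.Nh (lev + 1) : ℝ) ≤ 2 ^ lev * (2 : ℝ) ^ (n + 6) * Real.exp (G n) * P.X ∧
    (3 * Real.exp (G n) + 1) * (2 * (P.Nf lev n : ℝ) + 1) + P.Nf lev n ≤ 2 ^ lev * (2 : ℝ) ^ (n + 6) * Real.exp (G n) * P.X ∧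
    (P.Nf lev n : ℝ) ≤ 2 ^ lev * (2 : ℝ) ^ (n + 6) * Real.exp (G n) * P.X ∧
    0 ≤ (3 * Real.exp (G n) + 1) * (2 * (P.Nf lev n : ℝ) + 1) + P.Nf lev n ∧ (0 : ℝ) ≤ P.Nf lev n ∧ (0 : ℝ) ≤ P.Nh (lev + 1) := by
  obtain ⟨-, hNf, -, -, -⟩ := P.nodes_le lev n
  obtain ⟨-, -, hNh, -, -⟩ := P.nodes_le (lev + 1) 0
  have hX : (128 : ℝ) ≤ P.X := P.X_floors.2.1
  have hG1 : (1 : ℝ) ≤ Real.exp (G n) := Real.one_le_exp (G_pos n).le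
  have hNf0 : (0 : ℝ) ≤ P.Nf lev n := Nat.cast_nonneg _
  have hNh0 : (0 : ℝ) ≤ P.Nh (lev + 1) := Nat.cast_nonneg _
  have hpow : (2 : ℝ) ^ (n + lev) = 2 ^ n * 2 ^ lev := pow_add 2 n lev
  have hpow6 : (2 : ℝ) ^ (n + 6) = 2 ^ n * 64 := by rw [pow_add]; norm_num
  have h2n : (1 : ℝ) ≤ 2 ^ n := one_le_pow₀ (by norm_num)
  have h2l : (1 : ℝ) ≤ 2 ^ lev := one_le_pow₀ (by norm_num)
  -- the common size `M = 2^{n+lev}·X ≥ 1`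
  set M : ℝ := 2 ^ (n + lev) * P.X with hM
  have hM1 : (1 : ℝ) ≤ M := by rw [hM, hpow]; nlinarith [mul_le_mul h2n h2l zero_le_one (by positivity)]
  have hB : 2 ^ lev * (2 : ℝ) ^ (n + 6) * Real.exp (G n) * P.X = 64 * Real.exp (G n) * M := by rw [hM, hpow, hpow6]; ring
  rw [hB]
  have hM0 : 0 ≤ M := by linarith
  refine ⟨?_, ?_, ?_, by positivity, hNf0, hNh0⟩
  · -- `Nh (lev+1) ≤ 2^{lev+1}·X ≤ 2M ≤ 64 e^G M`
    have h1 : (P.Nh (lev + 1) : ℝ) ≤ 2 * M := by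
      rw [hM, hpow]; rw [pow_succ] at hNh; nlinarith [mul_nonneg (by positivity : (0:ℝ) ≤ 2 ^ lev) (by positivity : (0:ℝ) ≤ P.X)]
    nlinarith
  · -- `(3e^G+1)(2M+1) + M ≤ (9e^G + 4)·M ≤ 13 e^G M`
    have h1 : (3 * Real.exp (G n) + 1) * (2 * (P.Nf lev n : ℝ) + 1) ≤ (3 * Real.exp (G n) + 1) * (3 * M) :=
      mul_le_mul_of_nonneg_left (by linarith) (by positivity)
    nlinarith
  · nlinarith

/-- **the Hasse weight of the half step**: for `lev < Ŝ` and any radius `ρ ≤ 2^lev·2^{n+6}·e^G·X`,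
`log WC(H, Ŝ−(lev+1)+1, L₀, T′, ρ) ≤ T′·Ŝ·log 2 + X/8 + (0.22·Z + 19n + 47 + log N)` (p1's `logWC_le` + `L₀_mul_le`).
[cite: Nesterenko2003, §4.3 (4.44)–(4.47); shape only] -/
theorem logWC_half_le (hn2 : 2 ≤ n) {lev : ℕ} (hlev : lev < P.Sd) (T' : ℕ) {ρ : ℝ} (hρ0 : 0 ≤ ρ)
    (hρ : ρ ≤ 2 ^ lev * (2 : ℝ) ^ (n + 6) * Real.exp (G n) * P.X) :
    Real.log (WC P.H (P.Sd - (lev + 1) + 1) P.L₀ T' ρ) ≤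
      T' * (P.Sd * Real.log 2) + P.X / 8 + (22 / 100 * P.Z + (19 * n + 47 + Real.log P.N)) := by
  have he : P.Sd - (lev + 1) + 1 ≤ P.Sd := by omega
  have hx : P.Sd - (P.Sd - (lev + 1) + 1) = lev := by omega
  have h := P.logWC_le he T' hρ0 (by rw [hx]; exact hρ)
  have hL := P.L₀_mul_le hn2
  linarith

/-! ### Debris -/

/-- **the weights are sub-unit debris**: `n²·Ω ≤ Z/3072` (from `48·C_bⁿ·K·Ω ≤ L·WN ≤ Z/(64(n+1))`, `n ≤ 2ⁿ ≤ C_bⁿ`), hence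
`n·ΣA, ΣA, Σ_k Aθ_k, cHR ≤ Z/3072`. [folklore] -/
theorem nsq_Omega_le : (n : ℝ) ^ 2 * P.Ω ≤ P.Z / 3072 ∧ (n : ℝ) * P.SAR ≤ P.Z / 3072 ∧ P.SAR ≤ P.Z / 3072 ∧
    P.AθsumR ≤ P.Z / 3072 ∧ P.cHR ≤ P.Z / 3072 ∧ 0 ≤ P.SAR ∧ 0 ≤ P.AθsumR := by
  have h1 := P.Omega_le_L_WN
  obtain ⟨-, hZW, -, -⟩ := P.Z_floors
  obtain ⟨hS, hA, hS0⟩ := P.SAR_le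
  have hΩ := P.Ω_facts.1
  have hn := P.hn
  have hn1 : (1 : ℝ) ≤ n := by exact_mod_cast hn
  have hK1 : (1 : ℝ) ≤ K n := by exact_mod_cast one_le_K n
  have hCb : (86 : ℝ) ≤ Cb := (Cb_ge' hn).1
  have hCbn : (n : ℝ) ≤ Cb ^ n :=
    calc (n : ℝ) ≤ 2 ^ n := by exact_mod_cast (Nat.lt_two_pow_self).le
      _ ≤ Cb ^ n := pow_le_pow_left₀ (by norm_num) (by linarith) n
  have hAθ0 : 0 ≤ P.AθsumR := by
    unfold AθsumR AθR; exact Finset.sum_nonneg fun k _ => Finset.sum_nonneg fun j _ => (P.A_facts j).1.le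
  -- `n² Ω ≤ (n+1)·Cbⁿ·K·Ω ≤ (n+1)·L·WN/48 ≤ Z/3072`
  have h2 : (n : ℝ) ^ 2 * P.Ω ≤ ((n : ℝ) + 1) * (Cb ^ n * K n * P.Ω) := by
    have h3 : (n : ℝ) ^ 2 ≤ ((n : ℝ) + 1) * (Cb ^ n * K n) := by
      nlinarith [mul_le_mul hCbn hK1 zero_le_one (by positivity : (0:ℝ) ≤ Cb ^ n)]
    nlinarith
  have h4 : ((n : ℝ) + 1) * (Cb ^ n * K n * P.Ω) ≤ ((n : ℝ) + 1) * (P.L * P.WN) / 48 := by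
    rw [le_div_iff₀ (by norm_num)]; nlinarith
  have hmain : (n : ℝ) ^ 2 * P.Ω ≤ P.Z / 3072 := by rw [le_div_iff₀ (by norm_num)] at *; nlinarith
  have hnS : (n : ℝ) * P.SAR ≤ P.Z / 3072 := by nlinarith
  have hS' : P.SAR ≤ P.Z / 3072 := by nlinarith
  refine ⟨hmain, hnS, hS', by linarith, by unfold cHR; exact hnS, hS0, hAθ0⟩

/-- `cUR ≤ Z/392 + Z/2^29` (`yloadK ≥ 3G + 26 ≥ 98`; `n·WN, n·L/2^21, n + 1` against `Z ≥ 64(n+1)L·WN`, `Z ≥ 512(n+1)²L`,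
`L ≥ 2^{n+25}`) and `0 ≤ cUR`. [folklore] -/
theorem cUR_le' (hn2 : 2 ≤ n) : P.cUR ≤ P.Z / 392 + P.Z / 2 ^ 29 ∧ 0 ≤ P.cUR := by
  obtain ⟨hU, hU0⟩ := P.cUR_le
  obtain ⟨hZ0, hZW, hZn, -⟩ := P.Z_floors
  have hy := yloadK_ge P.hn
  have hG : G n = 8 * (n + 1) := G_eq n
  have hn : (2 : ℝ) ≤ n := by exact_mod_cast hn2
  have hL : (2 : ℝ) ^ 27 ≤ P.L :=
    calc (2 : ℝ) ^ 27 ≤ 2 ^ (n + 25) := pow_le_pow_right₀ (by norm_num) (by omega)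
      _ ≤ P.L := P.L_real.2.2.1
  have hWN := P.WN_bounds.2.2.2
  refine ⟨?_, hU0⟩
  have hy98 : (98 : ℝ) ≤ yloadK n := by rw [hG] at hy; linarith
  have h1 : P.Z / (4 * yloadK n) ≤ P.Z / 392 := div_le_div_of_nonneg_left hZ0.le (by norm_num) (by linarith)
  -- `n·WN ≤ Z/(64 L)`, `n·L ≤ Z/(512(n+1))`, `n + 1 ≤ Z/(512 (n+1) L)`
  have h2 : (n : ℝ) * P.WN * 2 ^ 33 ≤ P.Z := by nlinarith
  have h3 : (n : ℝ) * (P.L / 2 ^ 21) * 2 ^ 30 ≤ P.Z := by nlinarith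
  have h4 : ((n : ℝ) + 1) * 2 ^ 36 ≤ P.Z := by nlinarith
  nlinarith

/-- the additive debris of the half-step lines: `X/8 + (19n + 47 + log N) + 16 ≤ X·L/2^26`. [folklore] -/
theorem debris_le (hn2 : 2 ≤ n) : (P.X : ℝ) / 8 + (19 * n + 47 + Real.log P.N) + 16 ≤ (P.X : ℝ) * P.L / 2 ^ 26 := by
  have hX : (64 : ℝ) * (n + 1) ≤ P.X := by exact_mod_cast P.X_floors.1
  have hX8 := P.eight_WN_le_X
  have hlogN := P.WN_bounds.2.2.1
  have hn : (2 : ℝ) ≤ n := by exact_mod_cast hn2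
  have hL : (2 : ℝ) ^ 27 ≤ P.L :=
    calc (2 : ℝ) ^ 27 ≤ 2 ^ (n + 25) := pow_le_pow_right₀ (by norm_num) (by omega)
      _ ≤ P.L := P.L_real.2.2.1
  rw [le_div_iff₀ (by positivity)]
  nlinarith

/-! ### The jets radius and the slab at the half step -/

/-- **the jets radius of the half step**: for `|s| ≤ 2·Nh(lev+1) − 1`,
`|s|·Σ_j (LνRR lev j/N)·A_j ≤ (2 + 2⁻⁶)·n·X·L` (`|s| ≤ 2^{lev+1}X + 1`, p1's `Σ ≤ (1 + 2⁻²⁰)·n·L/2^lev`).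
[cite: Nesterenko2003, §4.3 (4.48); shape only] -/
theorem sAbs_sum_le (lev : ℕ) {s : ℤ} (hs : |s| ≤ 2 * (P.Nh (lev + 1) : ℤ) - 1) :
    |(s : ℝ)| * ∑ j, (P.LνRR lev j : ℝ) / P.N * P.A j ≤ (2 + 1 / 2 ^ 6) * n * ((P.X : ℝ) * P.L) ∧
    0 ≤ ∑ j, (P.LνRR lev j : ℝ) / P.N * P.A j ∧ |(s : ℝ)| ≤ 2 ^ (lev + 1) * P.X + 1 := by
  obtain ⟨-, hNh, -, -⟩ := P.nodes_half_le lev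
  obtain ⟨-, hSum⟩ := P.sum_LνRR_A_le lev
  have hSum0 := (P.LνRR_A_le lev).2.2
  have hX : (128 : ℝ) ≤ P.X := P.X_floors.2.1
  have hL := P.L_real.2.1
  have hn0 : (0 : ℝ) ≤ n := Nat.cast_nonneg n
  have h2l : (0 : ℝ) < 2 ^ lev := by positivity
  have h2l1 : (1 : ℝ) ≤ 2 ^ lev := one_le_pow₀ (by norm_num)
  have hs' : |(s : ℝ)| ≤ 2 * (P.Nh (lev + 1) : ℝ) - 1 := by
    have h := (Int.cast_le (R := ℝ)).mpr hs; push_cast at h; exact h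
  have hs2 : |(s : ℝ)| ≤ 2 ^ (lev + 1) * P.X + 1 := by rw [pow_succ]; nlinarith [hs', hNh]
  refine ⟨?_, hSum0, hs2⟩
  set S : ℝ := ∑ j, (P.LνRR lev j : ℝ) / P.N * P.A j with hS
  have hA : S * 2 ^ lev ≤ (1 + 1 / 2 ^ 20) * n * P.L := (le_div_iff₀ h2l).mp hSum
  have hB : S ≤ (1 + 1 / 2 ^ 20) * n * P.L := hSum.trans (div_le_self (by positivity) h2l1)
  have h1 : |(s : ℝ)| * S ≤ (2 ^ (lev + 1) * P.X + 1) * S := mul_le_mul_of_nonneg_right hs2 hSum0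
  have h2 : (2 ^ (lev + 1) * (P.X : ℝ) + 1) * S = 2 * P.X * (S * 2 ^ lev) + S := by rw [pow_succ]; ring
  rw [h2] at h1
  have h3 : 2 * (P.X : ℝ) * (S * 2 ^ lev) ≤ 2 * P.X * ((1 + 1 / 2 ^ 20) * n * P.L) := mul_le_mul_of_nonneg_left hA (by positivity)
  have h4 : (n : ℝ) * P.L ≤ (n : ℝ) * (P.X * P.L) / 128 := by
    rw [le_div_iff₀ (by norm_num)]; nlinarith [mul_nonneg hn0 hL.le]
  nlinarith [mul_nonneg hn0 (mul_nonneg (by positivity : (0:ℝ) ≤ P.X) hL.le)]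

/-- `e^{−(G+2)} ≤ 2⁻¹⁸` (`G ≥ 16`), `e^{−2} ≤ 0.1354`, `e^{−(G+2)}·e^{G} = e^{−2}`. [folklore] -/
theorem exp_consts (hn : 1 ≤ n) : Real.exp (-(G n + 2)) ≤ 1 / 2 ^ 18 ∧ Real.exp (-2 : ℝ) ≤ 1354 / 10000 ∧
    Real.exp (-(G n + 2)) * Real.exp (G n) = Real.exp (-2 : ℝ) := by
  have hn1 : (1 : ℝ) ≤ n := by exact_mod_cast hn
  have hG : (16 : ℝ) ≤ G n := by rw [G_eq]; linarith
  have he1 := Real.exp_one_gt_d9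
  have h2 : (2 : ℝ) ≤ Real.exp 1 := by linarith
  refine ⟨?_, ?_, by rw [← Real.exp_add]; ring_nf⟩
  · rw [Real.exp_neg, one_div]
    refine inv_anti₀ (by positivity) ?_
    calc (2 : ℝ) ^ 18 ≤ (Real.exp 1) ^ 18 := pow_le_pow_left₀ (by norm_num) h2 18
      _ = Real.exp 18 := by rw [← Real.exp_nat_mul]; norm_num
      _ ≤ Real.exp (G n + 2) := Real.exp_le_exp.mpr (by linarith)
  · rw [Real.exp_neg]
    have h3 : (10000 / 1354 : ℝ) ≤ Real.exp 2 := by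
      have : Real.exp 2 = (Real.exp 1) ^ 2 := by rw [← Real.exp_nat_mul]; norm_num
      rw [this]; nlinarith
    calc (Real.exp 2)⁻¹ ≤ (10000 / 1354 : ℝ)⁻¹ := inv_anti₀ (by norm_num) h3
      _ = 1354 / 10000 := by norm_num

/-- `wl lev·X ≤ X·L/2^18` and `wl lev ≤ X·L/2^25` (`wl lev ≤ L·e^{−(G+2)}`, `X ≥ 128`). [folklore] -/
theorem wl_X_le (lev : ℕ) : P.wl lev * P.X ≤ (P.X : ℝ) * P.L / 2 ^ 18 ∧ P.wl lev ≤ (P.X : ℝ) * P.L / 2 ^ 25 ∧ 0 ≤ P.wl lev := by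
  obtain ⟨hw0, hw, -, -, -, -⟩ := P.slab_real lev
  obtain ⟨he, -, -⟩ := exp_consts P.hn
  have hX : (128 : ℝ) ≤ P.X := P.X_floors.2.1
  have hL := P.L_real.2.1
  have h2l : (1 : ℝ) ≤ 2 ^ lev := one_le_pow₀ (by norm_num)
  have hε0 : 0 ≤ Real.exp (-(G n + 2)) := (Real.exp_pos _).le
  -- `wl lev ≤ L ε ≤ L/2^18`
  have h1 : P.wl lev ≤ (P.L : ℝ) * Real.exp (-(G n + 2)) := by
    rw [hw]; exact div_le_self (by positivity) h2l
  have h2 : (P.L : ℝ) * Real.exp (-(G n + 2)) ≤ P.L / 2 ^ 18 := by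
    have := mul_le_mul_of_nonneg_left he hL.le; linarith
  have h3 : P.wl lev ≤ (P.L : ℝ) / 2 ^ 18 := h1.trans h2
  refine ⟨?_, ?_, hw0⟩
  · have := mul_le_mul_of_nonneg_right h3 (by positivity : (0:ℝ) ≤ P.X)
    have h4 : (P.L : ℝ) / 2 ^ 18 * P.X = (P.X : ℝ) * P.L / 2 ^ 18 := by ring
    linarith
  · have h4 : (P.L : ℝ) / 2 ^ 18 ≤ (P.X : ℝ) * P.L / 2 ^ 25 := by
      rw [div_le_div_iff₀ (by norm_num) (by norm_num)]; nlinarith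
    exact h3.trans h4

end ArchG3Rec

end Summit.ABC.StewartYu

end
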